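import Mathlib
import Summits.ValiantsHypothesis.ValiantsHypothesis.Theorems.NewtonTauWeak.Negative.Zonogon
import Summits.ValiantsHypothesis.ValiantsHypothesis.Theorems.NewtonUnitEquationsDissociatedUniformGreedyCharts
import Summits.ValiantsHypothesis.ValiantsHypothesis.Theorems.NewtonUnitEquationsNewtonTauWeakAutomatonDefs
import Summits.ValiantsHypothesis.ValiantsHypothesis.Theorems.NewtonUnitEquationsNewtonTauWeakAutomatonGenDefs
import Summits.ValiantsHypothesis.ValiantsHypothesis.Theorems.NewtonUnitEquationsNewtonTauWeakAutomatonGreedyGen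
import Summits.ValiantsHypothesis.ValiantsHypothesis.Theorems.NewtonUnitEquationsNewtonTauWeakAutomatonStep
import Summits.ValiantsHypothesis.ValiantsHypothesis.Theorems.NewtonUnitEquationsNewtonTauWeakAutomatonGenCoeff
import Summits.ValiantsHypothesis.ValiantsHypothesis.Theorems.NewtonUnitEquationsNewtonTauWeakAutomatonGenRecursion
import Summits.ValiantsHypothesis.ValiantsHypothesis.Theorems.NewtonUnitEquationsNewtonTauWeakAutomatonGenSupport

/-!
# `NewtonUnitEquationsNewtonTauWeakAutomatonGenAssembly` — THEOREM B: a K-UNIFORM quasi-polynomial vertex bound on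
# every digit frame with level polynomials of bounded degree (crux `NewtonTauWeak`, stmt-ValiantsHypothesis-5904;
# line `binomial-normal-form`, registered stub `stub_genAssembly`)

`stub_genAssembly`: for EVERY number `k` of products, every degree bound `C`, every number `n` of levels, all scalars
`c` and all level polynomials `G l i` of degree `≤ C` in each variable,
`vert( Σ_{l<k} c_l Π_{i<n} G_{l,i}(x^{2^i}, y^{2^i}) ) ≤ (C+1)² · 4 · A ^ ⌈log₂ n⌉`, `A = 4D³ + 2D² + 2D + 2`,
`D = d²`, `d = k (C+1)⁴` — the verbatim generalisation of THEOREM A (`hex_digitHexagon_quasiPoly`,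
`…AutomatonAssembly.lean`: the digit hexagon, three binomials per level, carries in `{0,1}²`) to an arbitrary level
polynomial of bounded degree (carries in `{0, …, C}²`).
Proof (same assembly as Theorem A): the general carry automaton (`stub_genCoeff`: the coefficient array of the
`k`-sum is a linear image of the `d`-dimensional vector configuration `genVecFin`, `coeff_genSum_eq`), top survivors
are greedy (`stub_autoGreedyGen`: `vert ≤ (C+1)²·|cshadow|`, with the support bound `stub_genSupport`), bilinear
self-similarity (`stub_genRecursion`) and Theorem Q's product step (`stub_autoStep`) give the shadow recursion
`s(h+m) ≤ 2D²(D s(m) + D s(h) + 1) + 2D + 1` (`gen_shadow_step`), and halving (`Nat.clog`) closes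
(`gen_shadow_bound`; the induction hypothesis is quantified over all level polynomials, so the shifted polynomials
`shiftLev G h` of the high factor need no separate treatment). [folklore: Theorem Q for tensor trains]
-/

set_option linter.dupNamespace false

noncomputable section

open scoped BigOperators
open MvPolynomial
open Summit.ValiantsHypothesis.ValiantsHypothesis.Theorems.NewtonTauWeak.Negative (vert)
open Summit.ValiantsHypothesis.ValiantsHypothesis.Theorems.NewtonUnitEquationsDissociatedUniform (QuasiPoly.cshadow
  QuasiPoly.cshadow_subset QuasiPoly.cshadow_finite)

namespace Summit.ValiantsHypothesis.ValiantsHypothesis.Theorems.NewtonTauWeakAutomaton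

namespace GenAssemblyAux

/-! ## The shadow recursion of the level-`n` configuration (no new definitions: everything inlined) -/

-- adapted from NewtonUnitEquationsNewtonTauWeakAutomatonAssembly.lean (Theorem A, `shadow_le_card` … `shadow_bound`)

/-- Trivial bound: the shadow of the general configuration lies in the box `[0,2^n)²`, which has `2^n · 2^n`
points. -/
theorem gen_shadow_le_card (k C n : ℕ) (G : Fin k → ℕ → MvPolynomial (Fin 2) ℂ) :
    (QuasiPoly.cshadow (box n) (genVecFin k C G 0 n) (fun P => ((P.1 : ℕ) : ℝ)) (fun P => ((P.2 : ℕ) : ℝ))).ncard ≤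
      2 ^ n * 2 ^ n := by
  have hcard : (box n).card = 2 ^ n * 2 ^ n := by
    simp [box, Finset.card_product]
  rw [← hcard, ← Set.ncard_coe_finset]
  exact Set.ncard_le_ncard (QuasiPoly.cshadow_subset _ _ _ _) (Finset.finite_toSet _)

/-- The product step specialised to the general automaton (`stub_autoStep` + `stub_genRecursion`):
`s(h+m) ≤ 2D²(D·s_high(m) + D·s_low(h) + 1) + 2D + 1`, `D = d²`, `d = k (C+1)⁴`; the high factor is the level-`m`
configuration of the shifted level polynomials `shiftLev G h`. -/
theorem gen_shadow_step (k C h m : ℕ) (G : Fin k → ℕ → MvPolynomial (Fin 2) ℂ) (D : ℕ)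
    (hD : D = k * ((C + 1) * (C + 1) * ((C + 1) * (C + 1))) * (k * ((C + 1) * (C + 1) * ((C + 1) * (C + 1))))) :
    (QuasiPoly.cshadow (box (h + m)) (genVecFin k C G 0 (h + m)) (fun P => ((P.1 : ℕ) : ℝ))
        (fun P => ((P.2 : ℕ) : ℝ))).ncard ≤
      2 * (D * D * (D * (QuasiPoly.cshadow (box m) (genVecFin k C (shiftLev G h) 0 m) (fun P => ((P.1 : ℕ) : ℝ))
              (fun P => ((P.2 : ℕ) : ℝ))).ncard +
            D * (QuasiPoly.cshadow (box h) (genVecFin k C G 0 h) (fun P => ((P.1 : ℕ) : ℝ))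
              (fun P => ((P.2 : ℕ) : ℝ))).ncard + 1)) +
        D + D + 1 := by
  subst hD
  refine stub_autoStep h m (box (h + m)) (box m) (box h) rfl rfl rfl (genVecFin k C G 0 (h + m))
    (genVecFin k C (shiftLev G h) 0 m) (genVecFin k C G 0 h) (genContract k C) ?_
  intro H _ L hL
  have hL' : L.1 < 2 ^ h ∧ L.2 < 2 ^ h := by
    simpa [box, Finset.mem_product, Finset.mem_range] using hL
  exact stub_genRecursion k C h m G H L hL'

/-- **The shadow recursion, solved by halving**: with `A = 4D³ + 2D² + 2D + 2`, `D = d²`, `d = k (C+1)⁴`, the level-`n`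
general configuration has at most `4 · A^{⌈log₂ n⌉}` greedy positions, for ALL level polynomials `G` (so that the
induction hypothesis applies to the shifted polynomials of the high factor). [folklore] -/
theorem gen_shadow_bound (k C : ℕ) : ∀ n (G : Fin k → ℕ → MvPolynomial (Fin 2) ℂ),
    (QuasiPoly.cshadow (box n) (genVecFin k C G 0 n) (fun P => ((P.1 : ℕ) : ℝ)) (fun P => ((P.2 : ℕ) : ℝ))).ncard ≤
      4 * (4 * (k * ((C + 1) * (C + 1) * ((C + 1) * (C + 1))) * (k * ((C + 1) * (C + 1) * ((C + 1) * (C + 1))))) ^ 3 +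
        2 * (k * ((C + 1) * (C + 1) * ((C + 1) * (C + 1))) * (k * ((C + 1) * (C + 1) * ((C + 1) * (C + 1))))) ^ 2 +
        2 * (k * ((C + 1) * (C + 1) * ((C + 1) * (C + 1))) * (k * ((C + 1) * (C + 1) * ((C + 1) * (C + 1))))) + 2) ^
        Nat.clog 2 n := by
  intro n
  induction n using Nat.strong_induction_on with
  | _ n ih =>
    intro G
    set D : ℕ := k * ((C + 1) * (C + 1) * ((C + 1) * (C + 1))) * (k * ((C + 1) * (C + 1) * ((C + 1) * (C + 1))))
      with hD
    set A : ℕ := 4 * D ^ 3 + 2 * D ^ 2 + 2 * D + 2 with hA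
    rcases Nat.lt_or_ge n 2 with hn | hn
    · -- n = 0 or 1: the whole box has ≤ 4 points
      have hclog : Nat.clog 2 n = 0 := Nat.clog_of_right_le_one (by omega) 2
      rw [hclog, pow_zero, mul_one]
      refine (gen_shadow_le_card k C n G).trans ?_
      interval_cases n <;> norm_num
    · -- split n = h + m with h = n / 2, m = (n + 1) / 2
      set m : ℕ := (n + 1) / 2 with hm
      set h : ℕ := n / 2 with hh
      have hhm : h + m = n := by omega
      have hm_lt : m < n := by omega
      have hh_lt : h < n := by omega
      have hclog : Nat.clog 2 n = Nat.clog 2 m + 1 := by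
        rw [Nat.clog_of_two_le (by norm_num) hn]
        have hm' : (n + 2 - 1) / 2 = m := by omega
        rw [hm']
      have hclog_h : Nat.clog 2 h ≤ Nat.clog 2 m := Nat.clog_mono_right 2 (by omega)
      have ihm := ih m hm_lt (shiftLev G h)
      have ihh := ih h hh_lt G
      have step := gen_shadow_step k C h m G D hD
      rw [hhm] at step
      set c := Nat.clog 2 m with hc
      have hA1 : 1 ≤ A := by rw [hA]; omega
      have hpow : 1 ≤ A ^ c := Nat.one_le_pow _ _ hA1
      have ihh' : (QuasiPoly.cshadow (box h) (genVecFin k C G 0 h) (fun P => ((P.1 : ℕ) : ℝ))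
          (fun P => ((P.2 : ℕ) : ℝ))).ncard ≤ 4 * A ^ c :=
        ihh.trans (Nat.mul_le_mul_left _ (Nat.pow_le_pow_right hA1 hclog_h))
      rw [hclog, pow_succ]
      set S := A ^ c with hS
      set sm := (QuasiPoly.cshadow (box m) (genVecFin k C (shiftLev G h) 0 m) (fun P => ((P.1 : ℕ) : ℝ))
        (fun P => ((P.2 : ℕ) : ℝ))).ncard with hsm
      set sh := (QuasiPoly.cshadow (box h) (genVecFin k C G 0 h) (fun P => ((P.1 : ℕ) : ℝ))
        (fun P => ((P.2 : ℕ) : ℝ))).ncard with hsh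
      have e1 : sm ≤ 4 * S := ihm
      have e2 : sh ≤ 4 * S := ihh'
      calc (QuasiPoly.cshadow (box n) (genVecFin k C G 0 n) (fun P => ((P.1 : ℕ) : ℝ))
              (fun P => ((P.2 : ℕ) : ℝ))).ncard
          ≤ 2 * (D * D * (D * sm + D * sh + 1)) + D + D + 1 := step
        _ ≤ 2 * (D * D * (D * (4 * S) + D * (4 * S) + 1)) + D + D + 1 := by gcongr
        _ ≤ 4 * S * A := by
            rw [hA]
            nlinarith [hpow, Nat.zero_le D, Nat.zero_le (D * D), Nat.zero_le (D * D * D), Nat.zero_le S]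
        _ = 4 * (S * A) := by ring

/-! ## The coefficient array of the `k`-sum is a linear image of the configuration -/

/-- **The coefficient of the `k`-sum at `2^n t + P` is a fixed linear functional (depending on the final carry
`t ∈ {0, …, C}²`) of the configuration vector at `P`.** [folklore: `stub_genCoeff`] -/
theorem coeff_genSum_eq (k C n : ℕ) (c : Fin k → ℂ) (G : Fin k → ℕ → MvPolynomial (Fin 2) ℂ)
    (hG : ∀ l i, ∀ e ∈ (G l i).support, e 0 ≤ C ∧ e 1 ≤ C) (t : Fin (C + 1) × Fin (C + 1))
    (P : ℕ × ℕ) (hP : P ∈ box n) :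
    coeff (Finsupp.single 0 (2 ^ n * (t.1 : ℕ) + P.1) + Finsupp.single 1 (2 ^ n * (t.2 : ℕ) + P.2))
        (genSum k n c G) =
      (∑ l : Fin k, c l • LinearMap.proj (R := ℂ)
          (φ := fun _ : Fin (k * ((C + 1) * (C + 1) * ((C + 1) * (C + 1)))) => ℂ)
          (gidxEquiv k C (l, (((0 : Fin (C + 1)), (0 : Fin (C + 1))), t)))) (genVecFin k C G 0 n P) := by
  have hP' : P.1 < 2 ^ n ∧ P.2 < 2 ^ n := by
    simpa [box, Finset.mem_product, Finset.mem_range] using hP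
  unfold genSum
  rw [coeff_sum, LinearMap.sum_apply]
  refine Finset.sum_congr rfl fun l _ => ?_
  rw [coeff_C_mul, LinearMap.smul_apply, LinearMap.proj_apply, smul_eq_mul]
  congr 1
  rw [stub_genCoeff C (G l) (hG l) n t P hP']
  simp [genVecFin, genVec]

end GenAssemblyAux

open GenAssemblyAux

/-! ## THEOREM B -/

/-- **THEOREM B (K-uniform quasi-polynomial bound on every digit frame with bounded level degree).** For EVERY number
`k` of products, every degree bound `C`, every `n`, all scalars `c` and all level polynomials `G l i` of degree `≤ C`
in each variable, the Newton polygon of `genSum k n c G = Σ_{l<k} c_l Π_{i<n} G_{l,i}(x^{2^i}, y^{2^i})` has at most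
`(C+1)² · 4 · A^{⌈log₂ n⌉}` vertices, `A = 4D³ + 2D² + 2D + 2`, `D = (k (C+1)⁴)²` — i.e. `n^{O(log (k (C+1)))}`, uniformly
in `k` (the generalisation of Theorem A, `hex_digitHexagon_quasiPoly`, from the digit hexagon to an arbitrary level
polynomial of bounded degree).  Proof: `stub_autoGreedyGen` (vertices are greedy positions, `vert ≤ (C+1)²·|cshadow|`)
with the linear coefficient functionals of `coeff_genSum_eq` (`stub_genCoeff`) and the support bound `stub_genSupport`,
then `gen_shadow_bound` (`stub_autoStep` + `stub_genRecursion`, halving).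
[folklore: carry automaton + Theorem Q's greedy-shadow product step ("Theorem Q for tensor trains")] -/
theorem stub_genAssembly (k C n : ℕ) (c : Fin k → ℂ) (G : Fin k → ℕ → MvPolynomial (Fin 2) ℂ)
    (hG : ∀ l i, ∀ e ∈ (G l i).support, e 0 ≤ C ∧ e 1 ≤ C) :
    vert (genSum k n c G) ≤ (C + 1) * (C + 1) * (4 *
      (4 * (k * ((C + 1) * (C + 1) * ((C + 1) * (C + 1))) * (k * ((C + 1) * (C + 1) * ((C + 1) * (C + 1))))) ^ 3 +
        2 * (k * ((C + 1) * (C + 1) * ((C + 1) * (C + 1))) * (k * ((C + 1) * (C + 1) * ((C + 1) * (C + 1))))) ^ 2 +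
        2 * (k * ((C + 1) * (C + 1) * ((C + 1) * (C + 1))) * (k * ((C + 1) * (C + 1) * ((C + 1) * (C + 1))))) + 2) ^
      Nat.clog 2 n) := by
  have h1 := stub_autoGreedyGen C n (box n) rfl (genSum k n c G) (genVecFin k C G 0 n)
    (fun t => ∑ l : Fin k, c l • LinearMap.proj (R := ℂ)
      (φ := fun _ : Fin (k * ((C + 1) * (C + 1) * ((C + 1) * (C + 1)))) => ℂ)
      (gidxEquiv k C (l, (((0 : Fin (C + 1)), (0 : Fin (C + 1))), t))))
    (stub_genSupport k C n c G hG) (fun t P hP => coeff_genSum_eq k C n c G hG t P hP)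
  exact h1.trans (Nat.mul_le_mul_left _ (gen_shadow_bound k C n G))

end Summit.ValiantsHypothesis.ValiantsHypothesis.Theorems.NewtonTauWeakAutomaton

end
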